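import Summits.Ventures.PercRepro.RankLevelSetRuleQCell

/-!
# PercRepro — RULE Q AT THE TIGHT LAYER: THE CELL INEQUALITIES `RhatCell q k` BY KERNEL EVALUATION (RankLevelSetRuleQCellEvalQ4B; night-1, gen 14)

Each theorem `rhatCell_q_k : RhatCell q k` (`∀ m ≤ q, Φ(q+k, q) ≤ R̂(q, k, m)`, RankLevelSetRuleQCell) is discharged by
`interval_cases m` and `norm_num` on the unfolded binomial sums (`Nat.choose` by its recursion; the
`Finset.Ioo`-sums as `Finset.range`-sums via `sum_Ioo_nat`). No `native_decide`, no `decide` on the rationals. With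
`hallUp_of_ncard_eq_of_rhatCell` each cell gives the UP form of C-044 at the tight layer `#E = (q+k) + q` of the cell
`(q+k, q)` for every finite matroid; the DOWN form is `hallDown_of_ncard_eq`. Cells: (4,12), (4,13), (4,14), (4,15), (4,16).
Axioms: standard.
-/

namespace PercRepro

open Finset

/-- `Φ(16, 4) ≤ R̂(4, 12, 0)` (the cell `(16, 4)` at `#P = 0`), by kernel evaluation. -/
theorem rhatCell_4_12_0 : phiK (4 + 12) 4 ≤ rhat 4 12 0 := by
  simp only [rhat, phiK, mhat, sum_Ioo_nat]
  norm_num [Finset.sum_range_succ, Nat.choose, Nat.min_def]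

/-- `Φ(16, 4) ≤ R̂(4, 12, 1)` (the cell `(16, 4)` at `#P = 1`), by kernel evaluation. -/
theorem rhatCell_4_12_1 : phiK (4 + 12) 4 ≤ rhat 4 12 1 := by
  simp only [rhat, phiK, mhat, sum_Ioo_nat]
  norm_num [Finset.sum_range_succ, Nat.choose, Nat.min_def]

/-- `Φ(16, 4) ≤ R̂(4, 12, 2)` (the cell `(16, 4)` at `#P = 2`), by kernel evaluation. -/
theorem rhatCell_4_12_2 : phiK (4 + 12) 4 ≤ rhat 4 12 2 := by
  simp only [rhat, phiK, mhat, sum_Ioo_nat]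
  norm_num [Finset.sum_range_succ, Nat.choose, Nat.min_def]

/-- `Φ(16, 4) ≤ R̂(4, 12, 3)` (the cell `(16, 4)` at `#P = 3`), by kernel evaluation. -/
theorem rhatCell_4_12_3 : phiK (4 + 12) 4 ≤ rhat 4 12 3 := by
  simp only [rhat, phiK, mhat, sum_Ioo_nat]
  norm_num [Finset.sum_range_succ, Nat.choose, Nat.min_def]

/-- `Φ(16, 4) ≤ R̂(4, 12, 4)` (the cell `(16, 4)` at `#P = 4`), by kernel evaluation. -/
theorem rhatCell_4_12_4 : phiK (4 + 12) 4 ≤ rhat 4 12 4 := by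
  simp only [rhat, phiK, mhat, sum_Ioo_nat]
  norm_num [Finset.sum_range_succ, Nat.choose, Nat.min_def]

/-- The cell `(16, 4)` (`q = 4`, `k = 12`): `Φ(16, 4) ≤ R̂(4, 12, m)` for every `m ≤ 4`. -/
theorem rhatCell_4_12 : RhatCell 4 12 := by
  intro m hm
  interval_cases m
  · exact rhatCell_4_12_0
  · exact rhatCell_4_12_1
  · exact rhatCell_4_12_2
  · exact rhatCell_4_12_3
  · exact rhatCell_4_12_4

/-- `Φ(17, 4) ≤ R̂(4, 13, 0)` (the cell `(17, 4)` at `#P = 0`), by kernel evaluation. -/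
theorem rhatCell_4_13_0 : phiK (4 + 13) 4 ≤ rhat 4 13 0 := by
  simp only [rhat, phiK, mhat, sum_Ioo_nat]
  norm_num [Finset.sum_range_succ, Nat.choose, Nat.min_def]

/-- `Φ(17, 4) ≤ R̂(4, 13, 1)` (the cell `(17, 4)` at `#P = 1`), by kernel evaluation. -/
theorem rhatCell_4_13_1 : phiK (4 + 13) 4 ≤ rhat 4 13 1 := by
  simp only [rhat, phiK, mhat, sum_Ioo_nat]
  norm_num [Finset.sum_range_succ, Nat.choose, Nat.min_def]

/-- `Φ(17, 4) ≤ R̂(4, 13, 2)` (the cell `(17, 4)` at `#P = 2`), by kernel evaluation. -/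
theorem rhatCell_4_13_2 : phiK (4 + 13) 4 ≤ rhat 4 13 2 := by
  simp only [rhat, phiK, mhat, sum_Ioo_nat]
  norm_num [Finset.sum_range_succ, Nat.choose, Nat.min_def]

/-- `Φ(17, 4) ≤ R̂(4, 13, 3)` (the cell `(17, 4)` at `#P = 3`), by kernel evaluation. -/
theorem rhatCell_4_13_3 : phiK (4 + 13) 4 ≤ rhat 4 13 3 := by
  simp only [rhat, phiK, mhat, sum_Ioo_nat]
  norm_num [Finset.sum_range_succ, Nat.choose, Nat.min_def]

/-- `Φ(17, 4) ≤ R̂(4, 13, 4)` (the cell `(17, 4)` at `#P = 4`), by kernel evaluation. -/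
theorem rhatCell_4_13_4 : phiK (4 + 13) 4 ≤ rhat 4 13 4 := by
  simp only [rhat, phiK, mhat, sum_Ioo_nat]
  norm_num [Finset.sum_range_succ, Nat.choose, Nat.min_def]

/-- The cell `(17, 4)` (`q = 4`, `k = 13`): `Φ(17, 4) ≤ R̂(4, 13, m)` for every `m ≤ 4`. -/
theorem rhatCell_4_13 : RhatCell 4 13 := by
  intro m hm
  interval_cases m
  · exact rhatCell_4_13_0
  · exact rhatCell_4_13_1
  · exact rhatCell_4_13_2
  · exact rhatCell_4_13_3
  · exact rhatCell_4_13_4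

/-- `Φ(18, 4) ≤ R̂(4, 14, 0)` (the cell `(18, 4)` at `#P = 0`), by kernel evaluation. -/
theorem rhatCell_4_14_0 : phiK (4 + 14) 4 ≤ rhat 4 14 0 := by
  simp only [rhat, phiK, mhat, sum_Ioo_nat]
  norm_num [Finset.sum_range_succ, Nat.choose, Nat.min_def]

/-- `Φ(18, 4) ≤ R̂(4, 14, 1)` (the cell `(18, 4)` at `#P = 1`), by kernel evaluation. -/
theorem rhatCell_4_14_1 : phiK (4 + 14) 4 ≤ rhat 4 14 1 := by
  simp only [rhat, phiK, mhat, sum_Ioo_nat]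
  norm_num [Finset.sum_range_succ, Nat.choose, Nat.min_def]

/-- `Φ(18, 4) ≤ R̂(4, 14, 2)` (the cell `(18, 4)` at `#P = 2`), by kernel evaluation. -/
theorem rhatCell_4_14_2 : phiK (4 + 14) 4 ≤ rhat 4 14 2 := by
  simp only [rhat, phiK, mhat, sum_Ioo_nat]
  norm_num [Finset.sum_range_succ, Nat.choose, Nat.min_def]

/-- `Φ(18, 4) ≤ R̂(4, 14, 3)` (the cell `(18, 4)` at `#P = 3`), by kernel evaluation. -/
theorem rhatCell_4_14_3 : phiK (4 + 14) 4 ≤ rhat 4 14 3 := by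
  simp only [rhat, phiK, mhat, sum_Ioo_nat]
  norm_num [Finset.sum_range_succ, Nat.choose, Nat.min_def]

/-- `Φ(18, 4) ≤ R̂(4, 14, 4)` (the cell `(18, 4)` at `#P = 4`), by kernel evaluation. -/
theorem rhatCell_4_14_4 : phiK (4 + 14) 4 ≤ rhat 4 14 4 := by
  simp only [rhat, phiK, mhat, sum_Ioo_nat]
  norm_num [Finset.sum_range_succ, Nat.choose, Nat.min_def]

/-- The cell `(18, 4)` (`q = 4`, `k = 14`): `Φ(18, 4) ≤ R̂(4, 14, m)` for every `m ≤ 4`. -/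
theorem rhatCell_4_14 : RhatCell 4 14 := by
  intro m hm
  interval_cases m
  · exact rhatCell_4_14_0
  · exact rhatCell_4_14_1
  · exact rhatCell_4_14_2
  · exact rhatCell_4_14_3
  · exact rhatCell_4_14_4

/-- `Φ(19, 4) ≤ R̂(4, 15, 0)` (the cell `(19, 4)` at `#P = 0`), by kernel evaluation. -/
theorem rhatCell_4_15_0 : phiK (4 + 15) 4 ≤ rhat 4 15 0 := by
  simp only [rhat, phiK, mhat, sum_Ioo_nat]
  norm_num [Finset.sum_range_succ, Nat.choose, Nat.min_def]

/-- `Φ(19, 4) ≤ R̂(4, 15, 1)` (the cell `(19, 4)` at `#P = 1`), by kernel evaluation. -/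
theorem rhatCell_4_15_1 : phiK (4 + 15) 4 ≤ rhat 4 15 1 := by
  simp only [rhat, phiK, mhat, sum_Ioo_nat]
  norm_num [Finset.sum_range_succ, Nat.choose, Nat.min_def]

/-- `Φ(19, 4) ≤ R̂(4, 15, 2)` (the cell `(19, 4)` at `#P = 2`), by kernel evaluation. -/
theorem rhatCell_4_15_2 : phiK (4 + 15) 4 ≤ rhat 4 15 2 := by
  simp only [rhat, phiK, mhat, sum_Ioo_nat]
  norm_num [Finset.sum_range_succ, Nat.choose, Nat.min_def]

/-- `Φ(19, 4) ≤ R̂(4, 15, 3)` (the cell `(19, 4)` at `#P = 3`), by kernel evaluation. -/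
theorem rhatCell_4_15_3 : phiK (4 + 15) 4 ≤ rhat 4 15 3 := by
  simp only [rhat, phiK, mhat, sum_Ioo_nat]
  norm_num [Finset.sum_range_succ, Nat.choose, Nat.min_def]

/-- `Φ(19, 4) ≤ R̂(4, 15, 4)` (the cell `(19, 4)` at `#P = 4`), by kernel evaluation. -/
theorem rhatCell_4_15_4 : phiK (4 + 15) 4 ≤ rhat 4 15 4 := by
  simp only [rhat, phiK, mhat, sum_Ioo_nat]
  norm_num [Finset.sum_range_succ, Nat.choose, Nat.min_def]

/-- The cell `(19, 4)` (`q = 4`, `k = 15`): `Φ(19, 4) ≤ R̂(4, 15, m)` for every `m ≤ 4`. -/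
theorem rhatCell_4_15 : RhatCell 4 15 := by
  intro m hm
  interval_cases m
  · exact rhatCell_4_15_0
  · exact rhatCell_4_15_1
  · exact rhatCell_4_15_2
  · exact rhatCell_4_15_3
  · exact rhatCell_4_15_4

/-- `Φ(20, 4) ≤ R̂(4, 16, 0)` (the cell `(20, 4)` at `#P = 0`), by kernel evaluation. -/
theorem rhatCell_4_16_0 : phiK (4 + 16) 4 ≤ rhat 4 16 0 := by
  simp only [rhat, phiK, mhat, sum_Ioo_nat]
  norm_num [Finset.sum_range_succ, Nat.choose, Nat.min_def]

/-- `Φ(20, 4) ≤ R̂(4, 16, 1)` (the cell `(20, 4)` at `#P = 1`), by kernel evaluation. -/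
theorem rhatCell_4_16_1 : phiK (4 + 16) 4 ≤ rhat 4 16 1 := by
  simp only [rhat, phiK, mhat, sum_Ioo_nat]
  norm_num [Finset.sum_range_succ, Nat.choose, Nat.min_def]

/-- `Φ(20, 4) ≤ R̂(4, 16, 2)` (the cell `(20, 4)` at `#P = 2`), by kernel evaluation. -/
theorem rhatCell_4_16_2 : phiK (4 + 16) 4 ≤ rhat 4 16 2 := by
  simp only [rhat, phiK, mhat, sum_Ioo_nat]
  norm_num [Finset.sum_range_succ, Nat.choose, Nat.min_def]

/-- `Φ(20, 4) ≤ R̂(4, 16, 3)` (the cell `(20, 4)` at `#P = 3`), by kernel evaluation. -/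
theorem rhatCell_4_16_3 : phiK (4 + 16) 4 ≤ rhat 4 16 3 := by
  simp only [rhat, phiK, mhat, sum_Ioo_nat]
  norm_num [Finset.sum_range_succ, Nat.choose, Nat.min_def]

/-- `Φ(20, 4) ≤ R̂(4, 16, 4)` (the cell `(20, 4)` at `#P = 4`), by kernel evaluation. -/
theorem rhatCell_4_16_4 : phiK (4 + 16) 4 ≤ rhat 4 16 4 := by
  simp only [rhat, phiK, mhat, sum_Ioo_nat]
  norm_num [Finset.sum_range_succ, Nat.choose, Nat.min_def]

/-- The cell `(20, 4)` (`q = 4`, `k = 16`): `Φ(20, 4) ≤ R̂(4, 16, m)` for every `m ≤ 4`. -/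
theorem rhatCell_4_16 : RhatCell 4 16 := by
  intro m hm
  interval_cases m
  · exact rhatCell_4_16_0
  · exact rhatCell_4_16_1
  · exact rhatCell_4_16_2
  · exact rhatCell_4_16_3
  · exact rhatCell_4_16_4

end PercRepro
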